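import Mathlib
import Summits.Ventures.PercRepro2.CoinOrTailAlg
import Summits.Ventures.PercRepro2.CoinOrTailBlockAlg
import Summits.Ventures.PercRepro2.CoinOrTailBlockSums
import Summits.Ventures.PercRepro2.CoinOrTailMixLsm

/-!
# The OR-tail functional for COVERING markers: the block theorem without entry-disjointness
(blind cell PercRepro2, night-2 g10; proofs/NIGHT2-DARC.md §40)

`orTailCov_functional_nonneg`: the cleared functional of row 2′DARC at an OR-tail (entries
`r, q`, tail `a`, markers `m₁, m₂ ∈ U`) is nonnegative as soon as the markers COVER the
entries — `hcov`: a cluster of `U` that contains an entry but neither marker has weight `0`.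
Compared with §39 (`orTailDom_functional_nonneg`: `r ⟹ m₁` and `q ⟹ m₂`) the two domination
hypotheses are replaced by the single cover hypothesis; in particular ONE marker may dominate
BOTH entries while the other marker is arbitrary.

The proof is the block theorem of §39 (`orTailBlock_identity`, `orTailBlock_nonneg`) with the
two Ahlswede–Daykin steps `H1 : Λ₁₀Λ₀₁ ≤ Λ₀₀Λ₁₁` and `H2 : M₁₀M₀₁ ≤ Λ₀₀M₁₁` now UNCONDITIONAL
(`blockR_mul_le_all`, `blockG_mul_le_all`): the tail-mixed values are log-supermodular on all
pairs (`CoinOrTailMixLsm.lean`), so the blocks `(1, 0)` and `(0, 1)` need not be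
entry-disjoint.  The cover hypothesis enters only through `M₀₀ = Λ₀₀` (`blockG_zero_eq_cov`):
a cluster without markers has no entry, so the tail is never entered from it.
-/

namespace Summit.Ventures.PercRepro2.Coin

open Classical

section CovSums

variable {V : Type*} [Fintype V] [DecidableEq V] {R : Type*} [Field R] [LinearOrder R]
  [IsStrictOrderedRing R]

omit [Fintype V] in
/-- The `R`-value is nonnegative. -/
lemma rVal_nonneg' {A : Finset V → R} {r q a : V} {ρ τ : R} (hρ0 : 0 ≤ ρ) (hρ1 : ρ ≤ 1)
    (hτ0 : 0 ≤ τ) (hτ1 : τ ≤ 1) (hA0 : ∀ W, 0 ≤ A W) (W : Finset V) :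
    0 ≤ rVal A r q a ρ τ W := by
  unfold rVal
  have h0 := tailWt_nonneg (r := r) (q := q) hρ1 hτ1 W
  have h1 := tailWt_le_one (r := r) (q := q) hρ0 hτ0 hτ1 W
  exact add_nonneg (mul_nonneg h0 (hA0 _)) (mul_nonneg (by linarith) (hA0 _))

/-- **H1, unconditional**: `Λ₁₀ Λ₀₁ ≤ Λ₀₀ Λ₁₁` for ANY two markers. -/
theorem blockR_mul_le_all (U : Finset V) (ν A : Finset V → R) (m₁ m₂ r q a : V) (ρ τ : R)
    (hρ0 : 0 ≤ ρ) (hρ1 : ρ ≤ 1) (hτ0 : 0 ≤ τ) (hτ1 : τ ≤ 1) (hν0 : ∀ W, 0 ≤ ν W)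
    (hν : ∀ s ⊆ U, ∀ t ⊆ U, ν s * ν t ≤ ν (s ∩ t) * ν (s ∪ t)) (hA0 : ∀ W, 0 ≤ A W)
    (hA : ∀ s t : Finset V, A s * A t ≤ A (s ∩ t) * A (s ∪ t))
    (hmono : ∀ s t : Finset V, s ⊆ t → A t ≤ A s) :
    blockR U ν A m₁ m₂ r q a ρ τ true false * blockR U ν A m₁ m₂ r q a ρ τ false true ≤
      blockR U ν A m₁ m₂ r q a ρ τ false false * blockR U ν A m₁ m₂ r q a ρ τ true true := by
  unfold blockR
  have hr0 : ∀ W, 0 ≤ rVal A r q a ρ τ W := fun W =>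
    rVal_nonneg' hρ0 hρ1 hτ0 hτ1 hA0 W
  have h₁ : (0 : Finset V → R) ≤ fun W => ν W * rVal A r q a ρ τ W * cellWt m₁ m₂ true false W :=
    fun W => mul_nonneg (mul_nonneg (hν0 W) (hr0 W)) (cellWt_nonneg _ _ _ _ _)
  have h₂ : (0 : Finset V → R) ≤ fun W => ν W * rVal A r q a ρ τ W * cellWt m₁ m₂ false true W :=
    fun W => mul_nonneg (mul_nonneg (hν0 W) (hr0 W)) (cellWt_nonneg _ _ _ _ _)
  have h₃ : (0 : Finset V → R) ≤ fun W => ν W * rVal A r q a ρ τ W * cellWt m₁ m₂ false false W :=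
    fun W => mul_nonneg (mul_nonneg (hν0 W) (hr0 W)) (cellWt_nonneg _ _ _ _ _)
  have h₄ : (0 : Finset V → R) ≤ fun W => ν W * rVal A r q a ρ τ W * cellWt m₁ m₂ true true W :=
    fun W => mul_nonneg (mul_nonneg (hν0 W) (hr0 W)) (cellWt_nonneg _ _ _ _ _)
  have h : ∀ ⦃s : Finset V⦄, s ⊆ U → ∀ ⦃t : Finset V⦄, t ⊆ U →
      (fun W => ν W * rVal A r q a ρ τ W * cellWt m₁ m₂ true false W) s *
        (fun W => ν W * rVal A r q a ρ τ W * cellWt m₁ m₂ false true W) t ≤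
      (fun W => ν W * rVal A r q a ρ τ W * cellWt m₁ m₂ false false W) (s ∩ t) *
        (fun W => ν W * rVal A r q a ρ τ W * cellWt m₁ m₂ true true W) (s ∪ t) := by
    intro s hs t ht
    simp only
    have hc := cellWt_mul_le (R := R) m₁ m₂ true false false true s t
    simp only [Bool.true_and, Bool.and_true, Bool.false_or, Bool.or_false] at hc
    have hc' : cellWt (R := R) m₁ m₂ true false s * cellWt m₁ m₂ false true t ≤
        cellWt m₁ m₂ false false (s ∩ t) * cellWt m₁ m₂ true true (s ∪ t) := by
      simpa using hc
    calc ν s * rVal A r q a ρ τ s * cellWt m₁ m₂ true false s *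
          (ν t * rVal A r q a ρ τ t * cellWt m₁ m₂ false true t)
        = (ν s * ν t) * (rVal A r q a ρ τ s * rVal A r q a ρ τ t) *
            (cellWt m₁ m₂ true false s * cellWt m₁ m₂ false true t) := by ring
      _ ≤ (ν (s ∩ t) * ν (s ∪ t)) * (rVal A r q a ρ τ (s ∩ t) * rVal A r q a ρ τ (s ∪ t)) *
            (cellWt m₁ m₂ false false (s ∩ t) * cellWt m₁ m₂ true true (s ∪ t)) := by
          apply mul_le_mul
          · apply mul_le_mul (hν s hs t ht)
              (rVal_mul_le_all A r q a ρ τ hρ0 hρ1 hτ0 hτ1 hA0 hA hmono s t)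
            · exact mul_nonneg (hr0 _) (hr0 _)
            · exact mul_nonneg (hν0 _) (hν0 _)
          · exact hc'
          · exact mul_nonneg (cellWt_nonneg _ _ _ _ _) (cellWt_nonneg _ _ _ _ _)
          · exact mul_nonneg (mul_nonneg (hν0 _) (hν0 _)) (mul_nonneg (hr0 _) (hr0 _))
      _ = ν (s ∩ t) * rVal A r q a ρ τ (s ∩ t) * cellWt m₁ m₂ false false (s ∩ t) *
            (ν (s ∪ t) * rVal A r q a ρ τ (s ∪ t) * cellWt m₁ m₂ true true (s ∪ t)) := by ring
  have key := Finset.four_functions_theorem U h₁ h₂ h₃ h₄ h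
    (𝒜 := U.powerset) (ℬ := U.powerset) le_rfl le_rfl
  simpa only [Finset.powerset_infs_powerset_self, Finset.powerset_sups_powerset_self] using key

/-- **H2, unconditional**: `M₁₀ M₀₁ ≤ Λ₀₀ M₁₁` for ANY two markers. -/
theorem blockG_mul_le_all (U : Finset V) (ν A : Finset V → R) (m₁ m₂ r q a w : V) (ρ τ : R)
    (hρ0 : 0 ≤ ρ) (hρ1 : ρ ≤ 1) (hτ0 : 0 ≤ τ) (hτ1 : τ ≤ 1) (hν0 : ∀ W, 0 ≤ ν W)
    (hν : ∀ s ⊆ U, ∀ t ⊆ U, ν s * ν t ≤ ν (s ∩ t) * ν (s ∪ t)) (hA0 : ∀ W, 0 ≤ A W)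
    (hA : ∀ s t : Finset V, A s * A t ≤ A (s ∩ t) * A (s ∪ t))
    (hmono : ∀ s t : Finset V, s ⊆ t → A t ≤ A s) :
    blockG U ν A m₁ m₂ r q a w ρ τ true false * blockG U ν A m₁ m₂ r q a w ρ τ false true ≤
      blockR U ν A m₁ m₂ r q a ρ τ false false * blockG U ν A m₁ m₂ r q a w ρ τ true true := by
  unfold blockR blockG
  have hr0 : ∀ W, 0 ≤ rVal A r q a ρ τ W := fun W =>
    rVal_nonneg' hρ0 hρ1 hτ0 hτ1 hA0 W
  have hg0 : ∀ W, 0 ≤ gVal A r q a w ρ τ W := fun W =>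
    gVal_nonneg hρ0 hρ1 hτ0 hτ1 hA0 W
  have h₁ : (0 : Finset V → R) ≤
      fun W => ν W * gVal A r q a w ρ τ W * cellWt m₁ m₂ true false W :=
    fun W => mul_nonneg (mul_nonneg (hν0 W) (hg0 W)) (cellWt_nonneg _ _ _ _ _)
  have h₂ : (0 : Finset V → R) ≤
      fun W => ν W * gVal A r q a w ρ τ W * cellWt m₁ m₂ false true W :=
    fun W => mul_nonneg (mul_nonneg (hν0 W) (hg0 W)) (cellWt_nonneg _ _ _ _ _)
  have h₃ : (0 : Finset V → R) ≤
      fun W => ν W * rVal A r q a ρ τ W * cellWt m₁ m₂ false false W :=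
    fun W => mul_nonneg (mul_nonneg (hν0 W) (hr0 W)) (cellWt_nonneg _ _ _ _ _)
  have h₄ : (0 : Finset V → R) ≤
      fun W => ν W * gVal A r q a w ρ τ W * cellWt m₁ m₂ true true W :=
    fun W => mul_nonneg (mul_nonneg (hν0 W) (hg0 W)) (cellWt_nonneg _ _ _ _ _)
  have h : ∀ ⦃s : Finset V⦄, s ⊆ U → ∀ ⦃t : Finset V⦄, t ⊆ U →
      (fun W => ν W * gVal A r q a w ρ τ W * cellWt m₁ m₂ true false W) s *
        (fun W => ν W * gVal A r q a w ρ τ W * cellWt m₁ m₂ false true W) t ≤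
      (fun W => ν W * rVal A r q a ρ τ W * cellWt m₁ m₂ false false W) (s ∩ t) *
        (fun W => ν W * gVal A r q a w ρ τ W * cellWt m₁ m₂ true true W) (s ∪ t) := by
    intro s hs t ht
    simp only
    have hc := cellWt_mul_le (R := R) m₁ m₂ true false false true s t
    have hc' : cellWt (R := R) m₁ m₂ true false s * cellWt m₁ m₂ false true t ≤
        cellWt m₁ m₂ false false (s ∩ t) * cellWt m₁ m₂ true true (s ∪ t) := by
      simpa using hc
    calc ν s * gVal A r q a w ρ τ s * cellWt m₁ m₂ true false s *
          (ν t * gVal A r q a w ρ τ t * cellWt m₁ m₂ false true t)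
        = (ν s * ν t) * (gVal A r q a w ρ τ s * gVal A r q a w ρ τ t) *
            (cellWt m₁ m₂ true false s * cellWt m₁ m₂ false true t) := by ring
      _ ≤ (ν (s ∩ t) * ν (s ∪ t)) * (rVal A r q a ρ τ (s ∩ t) * gVal A r q a w ρ τ (s ∪ t)) *
            (cellWt m₁ m₂ false false (s ∩ t) * cellWt m₁ m₂ true true (s ∪ t)) := by
          apply mul_le_mul
          · apply mul_le_mul (hν s hs t ht)
              (gVal_mul_le_rVal_gVal_all A r q a w ρ τ hρ0 hρ1 hτ0 hτ1 hA0 hA hmono s t)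
            · exact mul_nonneg (hg0 _) (hg0 _)
            · exact mul_nonneg (hν0 _) (hν0 _)
          · exact hc'
          · exact mul_nonneg (cellWt_nonneg _ _ _ _ _) (cellWt_nonneg _ _ _ _ _)
          · exact mul_nonneg (mul_nonneg (hν0 _) (hν0 _)) (mul_nonneg (hr0 _) (hg0 _))
      _ = ν (s ∩ t) * rVal A r q a ρ τ (s ∩ t) * cellWt m₁ m₂ false false (s ∩ t) *
            (ν (s ∪ t) * gVal A r q a w ρ τ (s ∪ t) * cellWt m₁ m₂ true true (s ∪ t)) := by ring
  have key := Finset.four_functions_theorem U h₁ h₂ h₃ h₄ h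
    (𝒜 := U.powerset) (ℬ := U.powerset) le_rfl le_rfl
  simpa only [Finset.powerset_infs_powerset_self, Finset.powerset_sups_powerset_self] using key

omit [Fintype V] [IsStrictOrderedRing R] in
/-- **`M₀₀ = Λ₀₀` for covering markers**: a cluster without markers has no entry (`hcov`), so the
tail is never entered from it and its gate value is its `R`-value. -/
theorem blockG_zero_eq_cov (U : Finset V) (ν A : Finset V → R) (m₁ m₂ r q a w : V) (ρ τ : R)
    (hcov : ∀ W ⊆ U, m₁ ∉ W → m₂ ∉ W → (r ∈ W ∨ q ∈ W) → ν W = 0) :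
    blockG U ν A m₁ m₂ r q a w ρ τ false false = blockR U ν A m₁ m₂ r q a ρ τ false false := by
  unfold blockG blockR
  refine Finset.sum_congr rfl fun W hW => ?_
  have hWU : W ⊆ U := Finset.mem_powerset.1 hW
  by_cases hc : cellWt (R := R) m₁ m₂ false false W = 0
  · rw [hc, mul_zero, mul_zero]
  · obtain ⟨h1, h2⟩ := of_cellWt_ne_zero hc
    have hm1 : m₁ ∉ W := fun h => Bool.false_ne_true (h1.1 h)
    have hm2 : m₂ ∉ W := fun h => Bool.false_ne_true (h2.1 h)
    by_cases he : r ∈ W ∨ q ∈ W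
    · rw [hcov W hWU hm1 hm2 he]
      simp only [zero_mul]
    · obtain ⟨hr, hq⟩ := not_or.1 he
      rw [gVal_of_no_entry hr hq, rVal_of_no_entry hr hq]

/-- **THE OR-TAIL FUNCTIONAL IS NONNEGATIVE FOR COVERING MARKERS** (block theorem, cover
form).  Hypotheses: `a, w ∉ U`; `ρ, τ ∈ [0, 1]` the tail coins of the entries `r, q`; `ν ≥ 0`
log-supermodular on the subsets of `U`; the markers `m₁, m₂` COVER the entries
(`hcov : m₁ ∉ W → m₂ ∉ W → (r ∈ W ∨ q ∈ W) → ν W = 0`); `A ≥ 0` decreasing and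
log-supermodular.  Conclusion: the cleared functional `Λ² XY − Λ F_a Y − Λ F_b X + F_a F_b M ≥ 0`
with `Λ = Σ ν·rVal`, `F_a = Σ ν·rVal·1[m₁ ∈ W]`, `F_b = Σ ν·rVal·1[m₂ ∈ W]`, `M = Σ ν·gVal`,
`X = Σ ν·gVal·1[m₁ ∈ W]`, `Y = Σ ν·gVal·1[m₂ ∈ W]`, `XY = Σ ν·gVal·1[m₁ ∈ W]·1[m₂ ∈ W]`. -/
theorem orTailCov_functional_nonneg (U : Finset V) (ν A : Finset V → R) (m₁ m₂ r q a w : V)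
    (ρ τ : R) (_haU : a ∉ U) (_hwU : w ∉ U) (hρ0 : 0 ≤ ρ) (hρ1 : ρ ≤ 1) (hτ0 : 0 ≤ τ) (hτ1 : τ ≤ 1)
    (hν0 : ∀ W, 0 ≤ ν W) (hν : ∀ s ⊆ U, ∀ t ⊆ U, ν s * ν t ≤ ν (s ∩ t) * ν (s ∪ t))
    (hcov : ∀ W ⊆ U, m₁ ∉ W → m₂ ∉ W → (r ∈ W ∨ q ∈ W) → ν W = 0)
    (hA0 : ∀ W, 0 ≤ A W) (hA : ∀ s t : Finset V, A s * A t ≤ A (s ∩ t) * A (s ∪ t))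
    (hmono : ∀ s t : Finset V, s ⊆ t → A t ≤ A s) :
    0 ≤ (∑ W ∈ U.powerset, ν W * rVal A r q a ρ τ W) ^ 2 *
          (∑ W ∈ U.powerset, ν W * gVal A r q a w ρ τ W *
            ((if m₁ ∈ W then (1 : R) else 0) * (if m₂ ∈ W then (1 : R) else 0)))
        - (∑ W ∈ U.powerset, ν W * rVal A r q a ρ τ W) *
          (∑ W ∈ U.powerset, ν W * rVal A r q a ρ τ W * (if m₁ ∈ W then (1 : R) else 0)) *
          (∑ W ∈ U.powerset, ν W * gVal A r q a w ρ τ W * (if m₂ ∈ W then (1 : R) else 0))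
        - (∑ W ∈ U.powerset, ν W * rVal A r q a ρ τ W) *
          (∑ W ∈ U.powerset, ν W * rVal A r q a ρ τ W * (if m₂ ∈ W then (1 : R) else 0)) *
          (∑ W ∈ U.powerset, ν W * gVal A r q a w ρ τ W * (if m₁ ∈ W then (1 : R) else 0))
        + (∑ W ∈ U.powerset, ν W * rVal A r q a ρ τ W * (if m₁ ∈ W then (1 : R) else 0)) *
          (∑ W ∈ U.powerset, ν W * rVal A r q a ρ τ W * (if m₂ ∈ W then (1 : R) else 0)) *
          (∑ W ∈ U.powerset, ν W * gVal A r q a w ρ τ W) := by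
  have eΛ := sum_split_four U (fun W => ν W * rVal A r q a ρ τ W) m₁ m₂
  have eF1 := sum_split_fst U (fun W => ν W * rVal A r q a ρ τ W) m₁ m₂
  have eF2 := sum_split_snd U (fun W => ν W * rVal A r q a ρ τ W) m₁ m₂
  have eM := sum_split_four U (fun W => ν W * gVal A r q a w ρ τ W) m₁ m₂
  have eX := sum_split_fst U (fun W => ν W * gVal A r q a w ρ τ W) m₁ m₂
  have eY := sum_split_snd U (fun W => ν W * gVal A r q a w ρ τ W) m₁ m₂
  have eXY := sum_split_both U (fun W => ν W * gVal A r q a w ρ τ W) m₁ m₂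
  rw [eΛ, eF1, eF2, eM, eX, eY, eXY]
  have key := orTailBlock_nonneg
    (blockR U ν A m₁ m₂ r q a ρ τ false false) (blockR U ν A m₁ m₂ r q a ρ τ false true)
    (blockR U ν A m₁ m₂ r q a ρ τ true false) (blockR U ν A m₁ m₂ r q a ρ τ true true)
    (blockG U ν A m₁ m₂ r q a w ρ τ false false) (blockG U ν A m₁ m₂ r q a w ρ τ false true)
    (blockG U ν A m₁ m₂ r q a w ρ τ true false) (blockG U ν A m₁ m₂ r q a w ρ τ true true)
    (blockR_nonneg U ν A m₁ m₂ r q a ρ τ hρ0 hρ1 hτ0 hτ1 hν0 hA0 false false)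
    (blockG_nonneg U ν A m₁ m₂ r q a w ρ τ hρ0 hρ1 hτ0 hτ1 hν0 hA0 false true)
    (blockG_nonneg U ν A m₁ m₂ r q a w ρ τ hρ0 hρ1 hτ0 hτ1 hν0 hA0 true false)
    (blockG_nonneg U ν A m₁ m₂ r q a w ρ τ hρ0 hρ1 hτ0 hτ1 hν0 hA0 true true)
    (blockG_le_blockR U ν A m₁ m₂ r q a w ρ τ hρ0 hτ0 hτ1 hν0 hmono false true)
    (blockG_le_blockR U ν A m₁ m₂ r q a w ρ τ hρ0 hτ0 hτ1 hν0 hmono true false)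
    (blockG_le_blockR U ν A m₁ m₂ r q a w ρ τ hρ0 hτ0 hτ1 hν0 hmono true true)
    (blockG_zero_eq_cov U ν A m₁ m₂ r q a w ρ τ hcov)
    (blockR_mul_le_all U ν A m₁ m₂ r q a ρ τ hρ0 hρ1 hτ0 hτ1 hν0 hν hA0 hA hmono)
    (blockG_mul_le_all U ν A m₁ m₂ r q a w ρ τ hρ0 hρ1 hτ0 hτ1 hν0 hν hA0 hA hmono)
  unfold blockR blockG at key
  exact key

end CovSums

end Summit.Ventures.PercRepro2.Coin
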